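import Summits.QuantumFields.YangMills.Theorems.UnitScaleTiltProp7TorusGreen2HessianDecay
import HarnessLib

/-!
# Route `UnitScaleTilt`, crux K1 «MinimiserStabilityRegPr» (stmt-QuantumFields-19200), route-R E′ path (α′), residue (hK), far-field fork (A3), row (R3) FILE 2: DECAY OF THE THIRD
# DIFFERENCES OF THE ZERO-MODE-REMOVED BIHARMONIC TORUS GREEN FUNCTION `G̃₂(z) = L^{-d} Σ_{k≠0} cos(p_k·z)∕ε(p_k)²` IN `d = 3`, UNIFORM IN THE PERIOD —
# `|∇ₖ⁻∇ᵢ⁺∇ⱼ⁻G̃₂(z)|·dist(0,z)² ≤ C` for `z ≠ 0` (all patterns `(i,j,k)`, including the pure `∇ᵢ³`): the lattice, finite-volume form of `∂³|x| = O(|x|⁻²)` for the biharmonic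
# fundamental solution of `ℝ³` — the `G₂` third-difference row of (A3)'s biharmonic-level peeling (★routeR-w3 g5 NAMING 19:28:35Z (R3), SWAP 19:29:26Z «(R3) = w8»; (R3-aux) = px9)

Cell `ym3-torus`, D-0154 (3c) twin-width seat `ym-ust-19200-w8` (gen 7).  Sibling of FILE 1 ✓ `…Prop7TorusGreen2HessianDecay.hessian_mul_dist_le` (`|∇∇G̃₂|·dist ≤ C`) with one more
difference: the representation is FILE 1's ★ `hessian_eq` at `z` minus at `z − e_k` (`χ_q(z − e_k) = χ_q(z)·conj χ_q(e_k)` factors the tail), the heat part is px9's (R3-aux)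
✓ `…Prop7TorusHeatKernelThirdDiffThree.abs_thirdDiff_hessian_prod_torusHeatKernel_le_three` (`K·(((1∨s)+M²)³)⁻¹`, all `(i,j,k)`) with the weight `s` and his ✓ `integral_mul_inv_cube_le`
(`∫₀^S s·(((1∨s)+M²)³)⁻¹ ≤ M⁻²`), and the tail has THREE character factors (`≤ (π²∕2)ε·(πL∕4)ε`, ✓ `norm_torusChar_single_sub_one_mul_le` · ✓ `norm_single_sub_one_le_dispersion`), hence is
`O(L^{1−d}) = O(M⁻²)`.  THEOREMS ONLY (0 `def`, 0 `sorry`), `G̃₂` via the displayed definition hypothesis `hG` of record (★routeR-w3 g5 19:39:22Z); `--supports stmt-QuantumFields-19200`,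
count-neutral.  YM₃ on T³ is a ladder rung (R3), not the Clay problem; nothing here claims the stub, the crux, d = 4 or the gap.

WHAT IS PROVED (ns `…Theorems.Prop7TorusGreen2ThirdDiffDecay`; `∇ᵢ⁺∇ⱼ⁻F(z) := F(z+eᵢ) − F(z+eᵢ−eⱼ) − F(z) + F(z−eⱼ)`, third difference `:= ∇ᵢ⁺∇ⱼ⁻F(z) − ∇ᵢ⁺∇ⱼ⁻F(z − e_k)`, written out).
* §1 ★ `thirdDiff_eq` (any `d`) — `∇ₖ⁻∇ᵢ⁺∇ⱼ⁻G(z) = ∫₀^S s·∇ₖ⁻∇ᵢ⁺∇ⱼ⁻[∏_μ q^L_s](z) ds + L^{−d}Σ_{q≠0} (e^{−Sε_q}(1+Sε_q)∕ε_q²)·Re[χ_q(z)(1 − conj χ_q(e_k))(χ_q(eᵢ)−1)(1−conj χ_q(eⱼ))]`.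
* §2 ★ `abs_thirdDiff_tail_le` (any `d`) — at `S = L²` the tail is `≤ (π³∕4)·C₀^d·L∕L^d`, `C₀ = Σ_{n∈ℤ}2^{−|n|}`.
* §3 ★★★ `thirdDiff_mul_dist_sq_le` (`d = 3`) — `∃ C, ∀ L ≥ 1, ∀ G with hG, ∀ i j k, ∀ z ≠ 0: |∇ₖ⁻∇ᵢ⁺∇ⱼ⁻G(z)|·(Σ_μ z̃_μ²) ≤ C` (`C = 3K + (3π³∕16)C₀³`).
HONEST SCOPE.  A Literature-grade lattice lemma placed in the Summits lineage that needs it; no Yang–Mills statement is touched.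

References: G. F. Lawler, V. Limic, *Random Walk: A Modern Introduction*, CUP 2010, Thm 4.3.1, §6.3 [LawlerLimic2010]; G. F. Lawler, *Intersections of Random Walks* (1991)
Thm 1.5.5; T. Bałaban, CMP 99 (1985) 75–102 [Balaban1985RegularSpaces] ((1.36) p.82).
-/

set_option autoImplicit false

noncomputable section

open MeasureTheory Set Finset ZMod intervalIntegral
open scoped Real BigOperators ComplexConjugate

namespace Summit.QuantumFields.YangMills.Theorems.Prop7TorusGreen2ThirdDiffDecay

open Literature.Probability.LatticeModels
open Prop7TorusGreenGradientDecay Prop7TorusHeatKernelThirdDiffThree Prop7TorusGreen2HeatKernel Prop7TorusGreen2HessianDecay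

variable {d L : ℕ} [NeZero L]

/-! ## §1 The third differences of `G̃₂`: heat-kernel part plus Fourier tail -/

/-- ★ **The third differences of `G̃₂`, heat-kernel part plus Fourier tail**: if `G z = L^{−d}Σ_{q≠0} cos(p_q·z)∕ε(p_q)²` then for every `S`,
`∇ᵢ⁺∇ⱼ⁻G(z) − ∇ᵢ⁺∇ⱼ⁻G(z − e_k) = ∫₀^S s·(∇ᵢ⁺∇ⱼ⁻[∏q^L_s](z) − ∇ᵢ⁺∇ⱼ⁻[∏q^L_s](z − e_k)) ds + L^{−d}Σ_{q≠0} (e^{−Sε_q}(1+Sε_q)∕ε_q²)·Re[χ_q(z)(1 − conj χ_q(e_k))(χ_q(eᵢ)−1)(1−conj χ_q(eⱼ))]`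
(FILE 1's ✓ `hessian_eq` at `z` and at `z − e_k`, and `χ_q(z − e_k) = χ_q(z)·conj χ_q(e_k)`). [folklore] -/
theorem thirdDiff_eq (G : TorusSite d L → ℝ)
    (hG : ∀ z, G z = (∑ k ∈ (univ : Finset (TorusSite d L)).erase 0,
      Real.cos (∑ i, latticeMomentum L k i * ((z i).val : ℝ)) / dispersion (latticeMomentum L k) ^ 2) / (L : ℝ) ^ d)
    (z : TorusSite d L) (i j k : Fin d) (S : ℝ) :
    (G (z + Pi.single i 1) - G (z + Pi.single i 1 - Pi.single j 1) - G z + G (z - Pi.single j 1)) -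
      (G (z - Pi.single k 1 + Pi.single i 1) - G (z - Pi.single k 1 + Pi.single i 1 - Pi.single j 1) -
        G (z - Pi.single k 1) + G (z - Pi.single k 1 - Pi.single j 1)) =
      (∫ s in (0 : ℝ)..S, s *
        (((∏ μ, torusHeatKernel s ((z + Pi.single i 1 : TorusSite d L) μ)) -
            (∏ μ, torusHeatKernel s ((z + Pi.single i 1 - Pi.single j 1 : TorusSite d L) μ)) -
            (∏ μ, torusHeatKernel s (z μ)) + ∏ μ, torusHeatKernel s ((z - Pi.single j 1 : TorusSite d L) μ)) -
          ((∏ μ, torusHeatKernel s ((z - Pi.single k 1 + Pi.single i 1 : TorusSite d L) μ)) -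
            (∏ μ, torusHeatKernel s ((z - Pi.single k 1 + Pi.single i 1 - Pi.single j 1 : TorusSite d L) μ)) -
            (∏ μ, torusHeatKernel s ((z - Pi.single k 1 : TorusSite d L) μ)) +
            ∏ μ, torusHeatKernel s ((z - Pi.single k 1 - Pi.single j 1 : TorusSite d L) μ)))) +
      (∑ q ∈ (univ : Finset (TorusSite d L)).erase 0,
        Real.exp (-(S * dispersion (latticeMomentum L q))) * (1 + S * dispersion (latticeMomentum L q)) /
            dispersion (latticeMomentum L q) ^ 2 *
          (torusChar q z * (1 - conj (torusChar q (Pi.single k 1))) * (torusChar q (Pi.single i 1) - 1) *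
            (1 - conj (torusChar q (Pi.single j 1)))).re) / (L : ℝ) ^ d := by
  have hI : ∀ y : TorusSite d L, IntervalIntegrable (fun s : ℝ => s *
      ((∏ μ, torusHeatKernel s ((y + Pi.single i 1 : TorusSite d L) μ)) -
        (∏ μ, torusHeatKernel s ((y + Pi.single i 1 - Pi.single j 1 : TorusSite d L) μ)) -
        (∏ μ, torusHeatKernel s (y μ)) + ∏ μ, torusHeatKernel s ((y - Pi.single j 1 : TorusSite d L) μ))) volume 0 S :=
    fun y => (continuous_id.mul ((((continuous_prod_torusHeatKernel _).sub (continuous_prod_torusHeatKernel _)).sub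
      (continuous_prod_torusHeatKernel _)).add (continuous_prod_torusHeatKernel _))).intervalIntegrable _ _
  rw [hessian_eq G hG z i j S, hessian_eq G hG (z - Pi.single k 1) i j S, add_sub_add_comm,
    ← intervalIntegral.integral_sub (hI z) (hI (z - Pi.single k 1)), ← sub_div, ← Finset.sum_sub_distrib]
  congr 1
  · refine intervalIntegral.integral_congr fun s _ => ?_
    ring
  · congr 1
    refine Finset.sum_congr rfl fun q _ => ?_
    rw [torusChar_sub_right, ← mul_sub, ← Complex.sub_re]
    congr 2
    ring

/-! ## §2 The Fourier tail of the third differences at `S = L²` -/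

/-- ★ **The Fourier tail of the third differences of `G̃₂` is `O(L^{1−d})`**: with `C₀ = Σ_{n∈ℤ}2^{−|n|}`, for all `z, i, j, k`,
`|L^{−d}Σ_{q≠0} (e^{−L²ε_q}(1+L²ε_q)∕ε_q²)·Re[χ_q(z)(1−conj χ_q(e_k))(χ_q(eᵢ)−1)(1−conj χ_q(eⱼ))]| ≤ (π³∕4)·C₀^d·L∕L^d`: three character factors give `(πL∕4)ε_q·(π²∕2)ε_q`
(✓ `norm_single_sub_one_le_dispersion`, ✓ `norm_torusChar_single_sub_one_mul_le`), cancelling `ε_q²` outright; then `(1+x)e^{−x} ≤ 2e^{−x∕2}` and `Σ_q e^{−L²ε_q∕2} ≤ C₀^d` (px13's letters). [folklore] -/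
theorem abs_thirdDiff_tail_le (z : TorusSite d L) (i j k : Fin d) :
    |(∑ q ∈ (univ : Finset (TorusSite d L)).erase 0,
        Real.exp (-((L : ℝ) ^ 2 * dispersion (latticeMomentum L q))) * (1 + (L : ℝ) ^ 2 * dispersion (latticeMomentum L q)) /
            dispersion (latticeMomentum L q) ^ 2 *
          (torusChar q z * (1 - conj (torusChar q (Pi.single k 1))) * (torusChar q (Pi.single i 1) - 1) *
            (1 - conj (torusChar q (Pi.single j 1)))).re) / (L : ℝ) ^ d| ≤
      π ^ 3 / 4 * (∑' n : ℤ, (1 / 2 : ℝ) ^ n.natAbs) ^ d * (L : ℝ) / (L : ℝ) ^ d := by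
  classical
  have hL : (0 : ℝ) < L := by exact_mod_cast Nat.pos_of_ne_zero (NeZero.ne L)
  have hLd : (0 : ℝ) < (L : ℝ) ^ d := by positivity
  rw [abs_div, abs_of_pos hLd, div_le_div_iff_of_pos_right hLd]
  -- termwise bound
  have hterm : ∀ q ∈ (univ : Finset (TorusSite d L)).erase 0,
      |Real.exp (-((L : ℝ) ^ 2 * dispersion (latticeMomentum L q))) * (1 + (L : ℝ) ^ 2 * dispersion (latticeMomentum L q)) /
            dispersion (latticeMomentum L q) ^ 2 *
          (torusChar q z * (1 - conj (torusChar q (Pi.single k 1))) * (torusChar q (Pi.single i 1) - 1) *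
            (1 - conj (torusChar q (Pi.single j 1)))).re| ≤
        π ^ 3 / 4 * (L : ℝ) * ∏ μ, (1 / 2 : ℝ) ^ (q μ).valMinAbs.natAbs := by
    intro q hq
    have hq0 : q ≠ 0 := Finset.ne_of_mem_erase hq
    have hε := dispersion_latticeMomentum_pos hq0
    set ε : ℝ := dispersion (latticeMomentum L q) with hεdef
    have hx : 0 ≤ (L : ℝ) ^ 2 * ε := by positivity
    have hk1 : ‖1 - conj (torusChar q (Pi.single k 1))‖ ≤ π * L / 4 * ε := by
      rw [← norm_neg, neg_sub, ← Complex.norm_conj (conj (torusChar q (Pi.single k 1)) - 1), map_sub, map_one,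
        Complex.conj_conj]
      exact norm_single_sub_one_le_dispersion q hq0 k
    have hij : ‖torusChar q (Pi.single i 1) - 1‖ * ‖1 - conj (torusChar q (Pi.single j 1))‖ ≤ π ^ 2 / 2 * ε := by
      rw [← norm_neg (1 - conj (torusChar q (Pi.single j 1))), neg_sub,
        ← Complex.norm_conj (conj (torusChar q (Pi.single j 1)) - 1), map_sub, map_one, Complex.conj_conj]
      exact norm_torusChar_single_sub_one_mul_le q i j
    have hre : |(torusChar q z * (1 - conj (torusChar q (Pi.single k 1))) * (torusChar q (Pi.single i 1) - 1) *
        (1 - conj (torusChar q (Pi.single j 1)))).re| ≤ (π * L / 4 * ε) * (π ^ 2 / 2 * ε) := by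
      refine (Complex.abs_re_le_norm _).trans ?_
      rw [norm_mul, norm_mul, norm_mul, norm_torusChar, one_mul, mul_assoc]
      exact mul_le_mul hk1 hij (by positivity) (by positivity)
    have hexp : Real.exp (-((L : ℝ) ^ 2 * ε / 2)) ≤ ∏ μ, (1 / 2 : ℝ) ^ (q μ).valMinAbs.natAbs :=
      (exp_neg_half_sq_mul_dispersion_le q).trans (Finset.prod_le_prod (fun μ _ => (Real.exp_pos _).le)
        fun μ _ => exp_neg_four_mul_sq_le _)
    have hdec : (1 + (L : ℝ) ^ 2 * ε) * Real.exp (-((L : ℝ) ^ 2 * ε)) ≤ 2 * Real.exp (-((L : ℝ) ^ 2 * ε / 2)) :=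
      add_one_mul_exp_neg_le hx
    rw [abs_mul, abs_div, abs_mul, Real.abs_exp, abs_of_nonneg (by positivity : (0 : ℝ) ≤ 1 + (L : ℝ) ^ 2 * ε),
      abs_of_pos (by positivity : (0 : ℝ) < ε ^ 2)]
    calc Real.exp (-((L : ℝ) ^ 2 * ε)) * (1 + (L : ℝ) ^ 2 * ε) / ε ^ 2 *
          |(torusChar q z * (1 - conj (torusChar q (Pi.single k 1))) * (torusChar q (Pi.single i 1) - 1) *
            (1 - conj (torusChar q (Pi.single j 1)))).re|
        ≤ Real.exp (-((L : ℝ) ^ 2 * ε)) * (1 + (L : ℝ) ^ 2 * ε) / ε ^ 2 * ((π * L / 4 * ε) * (π ^ 2 / 2 * ε)) := by gcongr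
      _ = π ^ 3 * L / 8 * ((1 + (L : ℝ) ^ 2 * ε) * Real.exp (-((L : ℝ) ^ 2 * ε))) := by
          field_simp
          ring
      _ ≤ π ^ 3 * L / 8 * (2 * Real.exp (-((L : ℝ) ^ 2 * ε / 2))) := by gcongr
      _ = π ^ 3 / 4 * L * Real.exp (-((L : ℝ) ^ 2 * ε / 2)) := by ring
      _ ≤ π ^ 3 / 4 * L * ∏ μ, (1 / 2 : ℝ) ^ (q μ).valMinAbs.natAbs := by gcongr
  calc |∑ q ∈ (univ : Finset (TorusSite d L)).erase 0,
        Real.exp (-((L : ℝ) ^ 2 * dispersion (latticeMomentum L q))) * (1 + (L : ℝ) ^ 2 * dispersion (latticeMomentum L q)) /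
            dispersion (latticeMomentum L q) ^ 2 *
          (torusChar q z * (1 - conj (torusChar q (Pi.single k 1))) * (torusChar q (Pi.single i 1) - 1) *
            (1 - conj (torusChar q (Pi.single j 1)))).re|
      ≤ ∑ q ∈ (univ : Finset (TorusSite d L)).erase 0, π ^ 3 / 4 * L * ∏ μ, (1 / 2 : ℝ) ^ (q μ).valMinAbs.natAbs :=
        (Finset.abs_sum_le_sum_abs _ _).trans (Finset.sum_le_sum hterm)
    _ ≤ ∑ q : TorusSite d L, π ^ 3 / 4 * L * ∏ μ, (1 / 2 : ℝ) ^ (q μ).valMinAbs.natAbs :=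
        Finset.sum_le_sum_of_subset_of_nonneg (Finset.erase_subset _ _) fun _ _ _ => by positivity
    _ = π ^ 3 / 4 * L * (∑ κ : ZMod L, (1 / 2 : ℝ) ^ κ.valMinAbs.natAbs) ^ d := by
        rw [← Finset.mul_sum]
        congr 1
        rw [show (∑ κ : ZMod L, (1 / 2 : ℝ) ^ κ.valMinAbs.natAbs) ^ d =
            ∏ _μ : Fin d, ∑ κ : ZMod L, (1 / 2 : ℝ) ^ κ.valMinAbs.natAbs by
          rw [Finset.prod_const, Finset.card_univ, Fintype.card_fin],
          Finset.prod_univ_sum]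
        simp only [Fintype.piFinset_univ]
    _ ≤ π ^ 3 / 4 * L * (∑' n : ℤ, (1 / 2 : ℝ) ^ n.natAbs) ^ d := by
        gcongr
        exact sum_half_pow_valMinAbs_le
    _ = π ^ 3 / 4 * (∑' n : ℤ, (1 / 2 : ℝ) ^ n.natAbs) ^ d * L := by ring

/-! ## §3 ★★★ The third-difference decay of `G̃₂` in `d = 3` -/

/-- ★★★ **DECAY OF THE THIRD DIFFERENCES OF THE ZERO-MODE-REMOVED BIHARMONIC GREEN FUNCTION OF `(ℤ/Lℤ)³`, UNIFORMLY IN THE PERIOD.**  There is an absolute constant `C` such that for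
every `L ≥ 1`, every `G : (ℤ/Lℤ)³ → ℝ` with `G z = L⁻³ Σ_{q≠0} cos(p_q·z)∕ε(p_q)²` (`= G̃₂`), all directions `i, j, k` (every pattern, incl. `i = j = k`) and every `z ≠ 0`:
`|∇ᵢ⁺∇ⱼ⁻G(z) − ∇ᵢ⁺∇ⱼ⁻G(z − e_k)| · (Σ_μ z̃_μ²) ≤ C`
(`∇ᵢ⁺∇ⱼ⁻G(y) = G(y+eᵢ) − G(y+eᵢ−eⱼ) − G(y) + G(y−eⱼ)`, `z̃_μ = valMinAbs (z μ)`): the lattice, finite-volume form of `|∂³|x|| ≲ |x|⁻²`.  Heat-kernel part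
`≤ K·∫₀^{L²} s·(((1∨s)+M²)³)⁻¹ds ≤ K∕M²` (px9's ✓ `abs_thirdDiff_hessian_prod_torusHeatKernel_le_three` × `s`, ✓ `integral_mul_inv_cube_le`; `M = max_μ|z̃_μ| ≥ 1`), Fourier tail
`≤ (π³∕4)C₀³L⁻² ≤ (π³∕16)C₀³M⁻²` (✓ `abs_thirdDiff_tail_le`, `2M ≤ L`), and `Σz̃² ≤ 3M²`; `C = 3K + (3π³∕16)C₀³`. [folklore] -/
theorem thirdDiff_mul_dist_sq_le : ∃ C : ℝ, ∀ (L : ℕ) [NeZero L] (G : TorusSite 3 L → ℝ),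
    (∀ z, G z = (∑ k ∈ (univ : Finset (TorusSite 3 L)).erase 0,
      Real.cos (∑ i, latticeMomentum L k i * ((z i).val : ℝ)) / dispersion (latticeMomentum L k) ^ 2) / (L : ℝ) ^ 3) →
    ∀ (i j k : Fin 3) (z : TorusSite 3 L), z ≠ 0 →
      |(G (z + Pi.single i 1) - G (z + Pi.single i 1 - Pi.single j 1) - G z + G (z - Pi.single j 1)) -
          (G (z - Pi.single k 1 + Pi.single i 1) - G (z - Pi.single k 1 + Pi.single i 1 - Pi.single j 1) -
            G (z - Pi.single k 1) + G (z - Pi.single k 1 - Pi.single j 1))| *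
        (∑ μ, (((z μ).valMinAbs : ℤ) : ℝ) ^ 2) ≤ C := by
  obtain ⟨K, hK, hP⟩ := abs_thirdDiff_hessian_prod_torusHeatKernel_le_three
  set C₀ : ℝ := ∑' n : ℤ, (1 / 2 : ℝ) ^ n.natAbs with hC₀
  refine ⟨3 * K + 3 * π ^ 3 / 16 * C₀ ^ 3, ?_⟩
  intro L _ G hG i j k z hz
  have hL : (0 : ℝ) < L := by exact_mod_cast Nat.pos_of_ne_zero (NeZero.ne L)
  -- the largest centred coordinate
  obtain ⟨μ₀, -, hμ₀⟩ := Finset.exists_max_image (univ : Finset (Fin 3))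
    (fun μ => (z μ).valMinAbs.natAbs) Finset.univ_nonempty
  set M : ℝ := |((z μ₀).valMinAbs : ℝ)| with hM
  have hMμ : ∀ μ, |((z μ).valMinAbs : ℝ)| ≤ M := fun μ => by
    have h := hμ₀ μ (Finset.mem_univ μ)
    rw [hM, ← Int.cast_abs, ← Int.cast_abs, ← Int.natCast_natAbs, ← Int.natCast_natAbs]
    exact_mod_cast h
  have hM1 : 1 ≤ M := by
    obtain ⟨μ₁, hμ₁⟩ : ∃ μ, z μ ≠ 0 := by
      by_contra h
      push Not at h
      exact hz (funext h)
    have h1 : (z μ₁).valMinAbs ≠ 0 := fun h => hμ₁ ((ZMod.valMinAbs_eq_zero _).1 h)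
    have h2 : (1 : ℝ) ≤ |((z μ₁).valMinAbs : ℝ)| := by
      rw [← Int.cast_abs]
      exact_mod_cast Int.one_le_abs h1
    exact h2.trans (hMμ μ₁)
  have hM0 : 0 < M := by linarith
  have hML : 2 * M ≤ L := by
    have h := two_mul_abs_valMinAbs_le (z μ₀)
    rw [hM, ← Int.cast_abs]
    exact_mod_cast h
  -- the squared distance: `Σz̃² ≤ 3M²`
  have hdist0 : 0 ≤ ∑ μ, (((z μ).valMinAbs : ℤ) : ℝ) ^ 2 := Finset.sum_nonneg fun μ _ => sq_nonneg _
  have hdist : ∑ μ, (((z μ).valMinAbs : ℤ) : ℝ) ^ 2 ≤ 3 * M ^ 2 := by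
    calc ∑ μ, (((z μ).valMinAbs : ℤ) : ℝ) ^ 2 ≤ ∑ _μ : Fin 3, M ^ 2 :=
          Finset.sum_le_sum fun μ _ => by
            rw [← sq_abs]
            exact pow_le_pow_left₀ (abs_nonneg _) (hMμ μ) 2
      _ = 3 * M ^ 2 := by simp
  -- the third difference: heat-kernel part and tail at `S = L²`
  have hS : (0 : ℝ) ≤ (L : ℝ) ^ 2 := by positivity
  rw [thirdDiff_eq G hG z i j k ((L : ℝ) ^ 2)]
  have hmain : |∫ s in (0 : ℝ)..(L : ℝ) ^ 2, s *
      (((∏ μ, torusHeatKernel s ((z + Pi.single i 1 : TorusSite 3 L) μ)) -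
          (∏ μ, torusHeatKernel s ((z + Pi.single i 1 - Pi.single j 1 : TorusSite 3 L) μ)) -
          (∏ μ, torusHeatKernel s (z μ)) + ∏ μ, torusHeatKernel s ((z - Pi.single j 1 : TorusSite 3 L) μ)) -
        ((∏ μ, torusHeatKernel s ((z - Pi.single k 1 + Pi.single i 1 : TorusSite 3 L) μ)) -
          (∏ μ, torusHeatKernel s ((z - Pi.single k 1 + Pi.single i 1 - Pi.single j 1 : TorusSite 3 L) μ)) -
          (∏ μ, torusHeatKernel s ((z - Pi.single k 1 : TorusSite 3 L) μ)) +
          ∏ μ, torusHeatKernel s ((z - Pi.single k 1 - Pi.single j 1 : TorusSite 3 L) μ)))| ≤ K * (M ^ 2)⁻¹ := by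
    have hcM : ((z μ₀).valMinAbs : ℝ) ^ 2 = M ^ 2 := by rw [hM, sq_abs]
    have hb : ∀ s ∈ Set.Ioc (0 : ℝ) ((L : ℝ) ^ 2), |s *
        (((∏ μ, torusHeatKernel s ((z + Pi.single i 1 : TorusSite 3 L) μ)) -
            (∏ μ, torusHeatKernel s ((z + Pi.single i 1 - Pi.single j 1 : TorusSite 3 L) μ)) -
            (∏ μ, torusHeatKernel s (z μ)) + ∏ μ, torusHeatKernel s ((z - Pi.single j 1 : TorusSite 3 L) μ)) -
          ((∏ μ, torusHeatKernel s ((z - Pi.single k 1 + Pi.single i 1 : TorusSite 3 L) μ)) -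
            (∏ μ, torusHeatKernel s ((z - Pi.single k 1 + Pi.single i 1 - Pi.single j 1 : TorusSite 3 L) μ)) -
            (∏ μ, torusHeatKernel s ((z - Pi.single k 1 : TorusSite 3 L) μ)) +
            ∏ μ, torusHeatKernel s ((z - Pi.single k 1 - Pi.single j 1 : TorusSite 3 L) μ)))| ≤
        K * (s * ((max 1 s + M ^ 2) ^ 3)⁻¹) := by
      intro s hs
      rw [abs_mul, abs_of_pos hs.1]
      have h := hP L s hs.1 hs.2 z i j k μ₀
      rw [hcM] at h
      calc _ ≤ s * (K * ((max 1 s + M ^ 2) ^ 3)⁻¹) := mul_le_mul_of_nonneg_left h hs.1.le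
        _ = K * (s * ((max 1 s + M ^ 2) ^ 3)⁻¹) := by ring
    have hcont : IntervalIntegrable (fun s : ℝ => K * (s * ((max 1 s + M ^ 2) ^ 3)⁻¹)) volume 0 ((L : ℝ) ^ 2) := by
      refine Continuous.intervalIntegrable ?_ _ _
      refine continuous_const.mul (continuous_id.mul
        ((((continuous_const.max continuous_id).add continuous_const).pow 3).inv₀ fun s => ?_))
      exact pow_ne_zero 3 (add_pos_of_pos_of_nonneg (lt_of_lt_of_le one_pos (le_max_left 1 s)) (sq_nonneg M)).ne'
    calc _ ≤ ∫ s in (0 : ℝ)..(L : ℝ) ^ 2, K * (s * ((max 1 s + M ^ 2) ^ 3)⁻¹) := by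
          have h := intervalIntegral.norm_integral_le_of_norm_le hS
            (Filter.Eventually.of_forall fun s hs => (Real.norm_eq_abs _).le.trans (hb s hs)) hcont
          rwa [Real.norm_eq_abs] at h
      _ = K * ∫ s in (0 : ℝ)..(L : ℝ) ^ 2, s * ((max 1 s + M ^ 2) ^ 3)⁻¹ := intervalIntegral.integral_const_mul _ _
      _ ≤ K * (M ^ 2)⁻¹ := by
          gcongr
          exact integral_mul_inv_cube_le hM0 hS
  have htail := abs_thirdDiff_tail_le z i j k (L := L) (d := 3)
  rw [← hC₀] at htail
  -- `L/L³ = 1/L² ≤ 1/(4M²)`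
  have hL3 : (L : ℝ) / (L : ℝ) ^ 3 ≤ (4 * M ^ 2)⁻¹ := by
    rw [show (L : ℝ) / (L : ℝ) ^ 3 = ((L : ℝ) ^ 2)⁻¹ by field_simp]
    apply inv_anti₀ (by positivity)
    nlinarith
  calc _ ≤ (K * (M ^ 2)⁻¹ + π ^ 3 / 4 * C₀ ^ 3 * (L : ℝ) / (L : ℝ) ^ 3) * (3 * M ^ 2) :=
        mul_le_mul ((abs_add_le _ _).trans (add_le_add hmain htail)) hdist hdist0 (by positivity)
    _ ≤ (K * (M ^ 2)⁻¹ + π ^ 3 / 4 * C₀ ^ 3 * (4 * M ^ 2)⁻¹) * (3 * M ^ 2) := by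
        gcongr
        rw [mul_div_assoc]
        gcongr
    _ = 3 * K + 3 * π ^ 3 / 16 * C₀ ^ 3 := by
        field_simp
        ring

end Summit.QuantumFields.YangMills.Theorems.Prop7TorusGreen2ThirdDiffDecay
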